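import Literature.Probability.LatticeModels.IsingFieldModel
import Literature.Probability.LatticeModels.TorusZeroMode
import HarnessLib

/-!
# Transport of fixed-boundary-condition Ising expectations with a site-dependent field along
# graph embeddings with closed image

Topic `Probability/LatticeModels`; continues `IsingFieldModel`. The tree transports FIXED-boundary
expectations of the uniform-field model along an injection `φ : V ↪ V'` that is a graph
isomorphism on all edges at the volume and whose image is closed under such edges
(`TorusZeroMode.isingExpect_fixed_map`, with `edgesTouching_map`, `glue_map_fixed`). Here the
same bookkeeping is done for the model with a site-dependent field (`fieldExpect`):
`⟨f⟩^{η'}_{φ(Λ);β,h'} = ⟨f(· ∨_φ η')⟩^{η' ∘ φ}_{Λ;β,h}` when `h' ∘ φ = h` on `Λ`, where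
`σ ∨_φ η' = Function.extend φ σ η'` (`fieldExpect_fixed_map`; Friedli–Velenik 2017, §3.1: `ℋ^η_Λ`
involves only the edges of `ℰ^b_Λ` and the sites of `Λ`), and its specialisation to graph
automorphisms preserving the field (`fieldExpect_fixed_equiv`, e.g. the lattice translations,
Friedli–Velenik Def. 3.3 / Georgii Ch. 5), used for the periodicity of infinite-volume limits.

## References

* S. Friedli, Y. Velenik, *Statistical Mechanics of Lattice Systems* (CUP 2017), §3.1
  (eqs. (3.1)–(3.2), (3.6), Def. 3.3).
-/

noncomputable section

open MeasureTheory Finset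

namespace Literature.Probability.LatticeModels

variable {V V' : Type*}

section Transport

variable {G : SimpleGraph V} {G' : SimpleGraph V'} [DecidableEq V] [DecidableEq V']
  [G.LocallyFinite] [G'.LocallyFinite]

/-- **Transport of the fixed-boundary Hamiltonian with site-dependent field**:
`ℋ^{η'}_{φ(Λ);h'}(σ ∨_φ η') = ℋ^{η'∘φ}_{Λ;h}(σ)` when `h' ∘ φ = h` on `Λ` (bond terms edge by edge
via `edgesTouching_map`, field terms site by site). [cite: FriedliVelenik2017, §3.1 eqs. (3.2) and (3.6)] -/
theorem fieldHamiltonian_fixed_map (φ : V ↪ V') {Λ : Finset V}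
    (hadj : ∀ x ∈ Λ, ∀ y, (G'.Adj (φ x) (φ y) ↔ G.Adj x y))
    (hnb : ∀ x ∈ Λ, ∀ y', G'.Adj (φ x) y' → ∃ y, φ y = y')
    {h : V → ℝ} {h' : V' → ℝ} (hh : ∀ x ∈ Λ, h' (φ x) = h x) (η' : SpinConfig V')
    (σ : SpinConfig V) :
    fieldHamiltonian G' (Λ.map φ) h' (.fixed η') (Function.extend φ σ η') =
      fieldHamiltonian G Λ h (.fixed (η' ∘ φ)) σ := by
  have hs : ∀ x, spinAt (φ x) (Function.extend φ σ η') = spinAt x σ := fun x => by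
    simp only [spinAt, φ.injective.extend_apply]
  have hb : ∀ e : Sym2 V, bondSpin (Function.extend φ σ η') (Sym2.map φ e) = bondSpin σ e := by
    intro e
    induction e using Sym2.ind with
    | _ x y => simp only [Sym2.map_mk, bondSpin_mk, hs]
  simp only [fieldHamiltonian, interactionEdges_fixed, edgesTouching_map φ hadj hnb,
    Finset.sum_map, Function.Embedding.coeFn_mk, hb, hs]
  congr 1
  exact Finset.sum_congr rfl fun x hx => by rw [hh x hx]

/-- **Transport of fixed-boundary-condition expectations (site-dependent field) along a graph
embedding with closed image.** If `φ : V ↪ V'` is a graph isomorphism on the edges at the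
volume `Λ` and no edge of `G'` joins `φ(Λ)` to a vertex off the range of `φ`, then for fields
with `h' ∘ φ = h` on `Λ` and measurable `f`,
`⟨f⟩^{η'}_{φ(Λ);β,h'} = ⟨f(· ∨_φ η')⟩^{η'∘φ}_{Λ;β,h}` (Friedli–Velenik 2017, §3.1: the Gibbs
measure is determined by `ℰ^b_Λ`, the sites of `Λ` and the exterior spins they see); as the
tree's `isingExpect_fixed_map`, by reindexing the finite Boltzmann sums.
[cite: FriedliVelenik2017, §3.1, Def. 3.1] -/
theorem fieldExpect_fixed_map (φ : V ↪ V') {Λ : Finset V}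
    (hadj : ∀ x ∈ Λ, ∀ y, (G'.Adj (φ x) (φ y) ↔ G.Adj x y))
    (hnb : ∀ x ∈ Λ, ∀ y', G'.Adj (φ x) y' → ∃ y, φ y = y')
    (β : ℝ) {h : V → ℝ} {h' : V' → ℝ} (hh : ∀ x ∈ Λ, h' (φ x) = h x) (η' : SpinConfig V')
    {f : SpinConfig V' → ℝ} (hf : Measurable f) :
    fieldExpect G' (Λ.map φ) β h' (.fixed η') f =
      fieldExpect G Λ β h (.fixed (η' ∘ φ)) (fun σ => f (Function.extend φ σ η')) := by
  have hf' : Measurable fun σ : SpinConfig V => f (Function.extend φ σ η') :=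
    hf.comp (measurable_extend φ η')
  obtain ⟨e, hex⟩ := exists_equiv_map φ Λ
  have hw : ∀ τ : Λ → ℤˣ, fieldWeight G' (Λ.map φ) β h' (.fixed η') (τ ∘ e.symm) =
      fieldWeight G Λ β h (.fixed (η' ∘ φ)) τ := fun τ => by
    simp only [fieldWeight, glue_map_fixed φ Λ η' hex]
    rw [fieldHamiltonian_fixed_map φ hadj hnb hh]
  have he : ∀ τ : Λ → ℤˣ, (e.arrowCongr (Equiv.refl ℤˣ)) τ = τ ∘ e.symm := fun τ => rfl
  have hZ : fieldZ G' (Λ.map φ) β h' (.fixed η') = fieldZ G Λ β h (.fixed (η' ∘ φ)) := by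
    unfold fieldZ
    exact (Fintype.sum_equiv (e.arrowCongr (Equiv.refl ℤˣ)) _ _ fun τ => by rw [he, hw]).symm
  rw [fieldExpect_eq_sum_div G' _ β h' _ hf, fieldExpect_eq_sum_div G Λ β h _ hf', hZ]
  congr 1
  refine (Fintype.sum_equiv (e.arrowCongr (Equiv.refl ℤˣ)) _ _ fun τ => ?_).symm
  rw [he, hw, glue_map_fixed φ Λ η' hex]

end Transport

/-! ### Invariance under graph automorphisms preserving the field -/

section Automorphism

variable {G : SimpleGraph V} [DecidableEq V] [G.LocallyFinite]

omit [DecidableEq V] [G.LocallyFinite] in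
/-- Transport along a bijection is precomposition with the inverse. [folklore] -/
theorem extend_equiv_eq_comp_symm (φ : V ≃ V) (σ η' : SpinConfig V) :
    Function.extend φ σ η' = σ ∘ φ.symm := by
  funext x'
  obtain ⟨x, rfl⟩ := φ.surjective x'
  rw [Function.comp_apply, φ.symm_apply_apply, φ.injective.extend_apply]

/-- **Invariance of fixed-boundary expectations under a graph automorphism** preserving the
field on the volume: `⟨f⟩^{η'}_{φ(Λ);β,h'} = ⟨f(· ∘ φ⁻¹)⟩^{η'∘φ}_{Λ;β,h}` when `h' ∘ φ = h` on `Λ`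
(e.g. the translations of `ℤ^d`: Friedli–Velenik 2017, §3.1 Def. 3.3; Georgii 2011, Ch. 5).
[cite: FriedliVelenik2017, §3.1, Def. 3.3] -/
theorem fieldExpect_fixed_equiv (φ : V ≃ V) (hadj : ∀ x y, (G.Adj (φ x) (φ y) ↔ G.Adj x y))
    {Λ : Finset V} (β : ℝ) {h h' : V → ℝ} (hh : ∀ x ∈ Λ, h' (φ x) = h x) (η' : SpinConfig V)
    {f : SpinConfig V → ℝ} (hf : Measurable f) :
    fieldExpect G (Λ.map φ.toEmbedding) β h' (.fixed η') f =
      fieldExpect G Λ β h (.fixed (η' ∘ φ)) (fun σ => f (σ ∘ φ.symm)) := by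
  have := fieldExpect_fixed_map (G := G) (G' := G) φ.toEmbedding (Λ := Λ)
    (fun x _ y => hadj x y) (fun x _ y' _ => ⟨φ.symm y', φ.apply_symm_apply y'⟩) β hh η' hf
  simpa only [extend_equiv_eq_comp_symm, Equiv.coe_toEmbedding] using this

/-- In particular for the one-point function and a constant boundary condition `u`:
`⟨σ_{φ k}⟩^{u}_{φ(Λ);β,h'} = ⟨σ_k⟩^{u}_{Λ;β,h}` when `h' ∘ φ = h` on `Λ` (translation
covariance of the finite-volume magnetisation, Friedli–Velenik 2017, proof of Prop. 3.29:
`⟨σ_i⟩⁺_{i+B(k)} = ⟨σ_0⟩⁺_{B(k)}`). [cite: FriedliVelenik2017, Prop. 3.29 (proof)] -/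
theorem fieldExpect_fixed_const_equiv_spinAt (φ : V ≃ V)
    (hadj : ∀ x y, (G.Adj (φ x) (φ y) ↔ G.Adj x y)) {Λ : Finset V} (β : ℝ) {h h' : V → ℝ}
    (hh : ∀ x ∈ Λ, h' (φ x) = h x) (u : ℤˣ) (k : V) :
    fieldExpect G (Λ.map φ.toEmbedding) β h' (.fixed fun _ => u) (spinAt (φ k)) =
      fieldExpect G Λ β h (.fixed fun _ => u) (spinAt k) := by
  rw [fieldExpect_fixed_equiv φ hadj β hh (fun _ => u) (measurable_spinAt _)]
  congr 1
  funext σ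
  simp [spinAt]

end Automorphism

end Literature.Probability.LatticeModels

end
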